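import Summits.QuantumFields.YangMills.Theorems.AtomicSynthesisWeightedFlatten
import Summits.QuantumFields.YangMills.Theorems.AtomicSynthesisSingleSlotReduction
import Summits.QuantumFields.YangMills.Theorems.AtomicSynthesisMolliApprox
import Summits.QuantumFields.YangMills.Theorems.AtomicSynthesisRiemannDisc

/-!
# Weighted atomic synthesis (for the tempered E3T stub of leaf 19868), part 3: one weighted round from the landed
H1/H4a/H4b at moment order `K + 6`; weighted single-slot synthesis holds for every profile and every `K`

Free-hands helper toward the registered stub E3T `stub_temperedMomentBoundA` of LINES «TemperedPeak» REV 2 /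
«OctaveDoubling» REV 2.1 on the leaf `InfiniteVolumeContinuum.HypercubicOSDataFromInfiniteVolume` (stmt-QuantumFields-19868).
Twin of the landed `oneStepExists6_of_split` (`AtomicSynthesisSingleSlotReduction`) at general order: the tree's
`momentKilling b hb hI N`, `molliApprox b N` and `riemannDisc b N` hold for EVERY `N`; at `N = K + 6` the mollification
error is `C₁ (τ/σ)^{K+6} A/τ^m = C₁ θ^{K+6} A/τ^m ≤ θ^{K+5} A/(2τ^m)` for `θ ≤ 1/(2(C₁+1))`, and the Riemann error
`(C₂/m₀) A/τ^m ≤ θ^{K+5} A/(2τ^m)` for `m₀ = ⌈2(C₂+1)/θ^{K+5}⌉₊ + 1` — one round with contraction `θ^{K+5}`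
(`oneStepW_of_split`), whence `slotSynthW_exists : ∀ b K, … → ∃ C₁ N₁, 0 ≤ C₁ ∧ SlotSynthW b C₁ N₁ K` by part 2.
Elementary; no stub/crux/rung/summit is closed by this file; the YM mass gap is NOT proved. [folklore]
-/

set_option autoImplicit false

noncomputable section

open scoped BigOperators Topology ContDiff
open MeasureTheory Filter Metric
open Summit.QuantumFields.YangMills.Cruxes.AtomicSynthesis.SingleSlotPlan
  (E4 Stage MomentKilling MolliApprox RiemannDisc combKernel kSmooth momentKilling molliApprox riemannDisc)

namespace Summit.QuantumFields.YangMills.Theorems.AtomicSynthesisWeighted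

/-- **Weighted H4 composition.**  H1 at order `K+6`, H4a and H4b give one WEIGHTED round: `θ = min (1/2) (1/(2(C₁+1)))`,
`m₀ = ⌈2(C₂+1)/θ^{K+5}⌉₊ + 1`, `C = C₂`, `R = R₂`, contraction `θ^{K+5}`. [folklore] -/
theorem oneStepW_of_split (b : SchwartzMap E4 ℝ) (K : ℕ)
    (hM : HasCompactSupport (b : E4 → ℝ) → (∫ y, b y) ≠ 0 → MomentKilling b (K + 6))
    (hA : MolliApprox b (K + 6)) (hB : RiemannDisc b (K + 6)) :
    HasCompactSupport (b : E4 → ℝ) → (∫ y, b y) ≠ 0 →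
      ∃ θ C R : ℝ, 0 < θ ∧ θ < 1 ∧ 0 ≤ C ∧ 0 ≤ R ∧ OneStepW b (K + 6) K θ C R := by
  intro hb hI
  obtain ⟨J₀, lam, u, hint, hmom⟩ := hM hb hI
  set I : ℝ := ∫ y, b y with hIdef
  -- the normalised kernel weights
  set w : Fin J₀ → ℝ := fun j => I⁻¹ * lam j with hw
  have hK : ∀ v, combKernel b w u v = I⁻¹ * ∑ j, lam j * b (v - u j) := by
    intro v; simp only [combKernel, hw, Finset.mul_sum, mul_assoc]
  have hK1 : (∫ y, combKernel b w u y) = 1 := by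
    simp_rw [hK]
    rw [integral_const_mul, hint, hIdef, inv_mul_cancel₀ hI]
  have hKmom : ∀ α : Fin 4 → ℕ, 1 ≤ ∑ i, α i → ∑ i, α i < K + 6 →
      ∫ y, combKernel b w u y * ∏ i, (y i) ^ (α i) = 0 := by
    intro α h1 h2
    simp_rw [hK, mul_assoc]
    rw [integral_const_mul, hmom α h1 h2, mul_zero]
  obtain ⟨C₁, hC₁, hS1⟩ := hA hb J₀ w u hK1 hKmom
  obtain ⟨C₂, R₂, hC₂, hR₂, hS2⟩ := hB hb J₀ w u
  -- the ratio and the oversampling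
  set θ : ℝ := min (1 / 2) (1 / (2 * (C₁ + 1))) with hθdef
  have hθpos : 0 < θ := by rw [hθdef]; positivity
  have hθhalf : θ ≤ 1 / 2 := min_le_left _ _
  have hθ1 : θ < 1 := by linarith
  have hθC : C₁ * θ ≤ 1 / 2 := by
    have h1 : θ ≤ 1 / (2 * (C₁ + 1)) := min_le_right _ _
    have h2 : C₁ * θ ≤ C₁ * (1 / (2 * (C₁ + 1))) := mul_le_mul_of_nonneg_left h1 hC₁
    have h3 : C₁ * (1 / (2 * (C₁ + 1))) ≤ 1 / 2 := by
      rw [mul_one_div, div_le_iff₀ (by positivity)]; nlinarith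
    linarith
  set m₀ : ℕ := ⌈2 * (C₂ + 1) / θ ^ (K + 5)⌉₊ + 1 with hm₀def
  have hm₀1 : 1 ≤ m₀ := by rw [hm₀def]; omega
  have hm₀pos : (0 : ℝ) < m₀ := by exact_mod_cast hm₀1
  have hθ5 : 0 < θ ^ (K + 5) := pow_pos hθpos _
  have hm₀C : C₂ / m₀ ≤ θ ^ (K + 5) / 2 := by
    have h1 : 2 * (C₂ + 1) / θ ^ (K + 5) ≤ m₀ := by
      rw [hm₀def]
      have := Nat.le_ceil (2 * (C₂ + 1) / θ ^ (K + 5))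
      push_cast
      linarith
    rw [div_le_iff₀ hm₀pos]
    rw [div_le_iff₀ hθ5] at h1
    nlinarith
  refine ⟨θ, C₂, R₂, hθpos, hθ1, hC₂, hR₂, ?_⟩
  intro f c ϱ σ A hf hσ hσϱ hA0 hsupp hbd
  have hτ : 0 < θ * σ := mul_pos hθpos hσ
  have hτσ : θ * σ ≤ σ := by nlinarith
  obtain ⟨hg, h1bd⟩ := hS1 f c ϱ σ A (θ * σ) hf hτ hτσ hσϱ hA0 hsupp hbd
  obtain ⟨J, a, η, hη, hmass, hcd, hts, herr⟩ := hS2 f c ϱ σ A (θ * σ) hf hτ hτσ hσϱ hA0 hsupp hbd m₀ hm₀1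
  refine ⟨J, a, η, hη, hmass, hf.sub hcd, ?_, ?_⟩
  · -- support of the residual
    refine closure_minimal ?_ isClosed_closedBall
    intro z hz
    rw [Function.mem_support] at hz
    by_cases hfz : f z = 0
    · have hSz : (fun x => ∑ j, a j * b ((θ * σ)⁻¹ • (x - η j))) z ≠ 0 := by
        intro h0; apply hz; simp only at h0; rw [hfz, h0, sub_zero]
      exact hts (subset_closure (Function.mem_support.2 hSz))
    · have : z ∈ closedBall c ϱ := hsupp (subset_closure (Function.mem_support.2 hfz))
      rw [mem_closedBall] at this ⊢
      nlinarith [mul_nonneg hR₂ hτ.le]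
  · -- the derivative bounds
    intro m hm z
    have hsplit : (fun x => f x - ∑ j, a j * b ((θ * σ)⁻¹ • (x - η j))) =
        (fun x => f x - kSmooth (combKernel b w u) (θ * σ) f x) +
        (fun x => kSmooth (combKernel b w u) (θ * σ) f x - ∑ j, a j * b ((θ * σ)⁻¹ • (x - η j))) := by
      funext x; simp only [Pi.add_apply]; ring
    have hm' : (m : WithTop ℕ∞) ≤ ∞ := by exact_mod_cast le_top
    have hd1 : ContDiff ℝ m (fun x => f x - kSmooth (combKernel b w u) (θ * σ) f x) := (hf.sub hg).of_le hm'
    have hd2 : ContDiff ℝ m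
        (fun x => kSmooth (combKernel b w u) (θ * σ) f x - ∑ j, a j * b ((θ * σ)⁻¹ • (x - η j))) :=
      (hg.sub hcd).of_le hm'
    rw [hsplit, iteratedFDeriv_add_apply hd1.contDiffAt hd2.contDiffAt]
    refine (norm_add_le _ _).trans ?_
    have e1 := h1bd m hm z
    have e2 := herr m hm z
    have hτm : 0 < (θ * σ) ^ m := pow_pos hτ m
    have hθσ : θ * σ / σ = θ := by field_simp
    rw [hθσ] at e1
    -- `C₁ θ^{K+6} A/τ^m + (C₂/m₀) A/τ^m ≤ θ^{K+5} A/τ^m`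
    have key : C₁ * θ ^ (K + 6) * A / (θ * σ) ^ m + C₂ / m₀ * A / (θ * σ) ^ m ≤
        θ ^ (K + 5) * A / (θ * σ) ^ m := by
      rw [← add_div, div_le_div_iff_of_pos_right hτm]
      have h1 : C₁ * θ ^ (K + 6) ≤ θ ^ (K + 5) / 2 := by
        have : C₁ * θ ^ (K + 6) = (C₁ * θ) * θ ^ (K + 5) := by ring
        rw [this]; nlinarith
      nlinarith
    linarith

/-- **Weighted single-slot synthesis holds** for every compactly supported Schwartz bump with non-zero integral and
every weight exponent `K` (at derivative order `N₁ = K + 6`), by the landed H1/H4a/H4b at order `K+6`, the weighted round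
(`oneStepW_of_split`) and the weighted flattening (`slotSynthW_of_oneStepW`). [folklore] -/
theorem slotSynthW_exists (b : SchwartzMap E4 ℝ) (hb : HasCompactSupport (b : E4 → ℝ)) (hI : (∫ y, b y) ≠ 0)
    (K : ℕ) : ∃ (C₁ : ℝ) (N₁ : ℕ), 0 ≤ C₁ ∧ SlotSynthW b C₁ N₁ K := by
  obtain ⟨θ, C, R, hθ, hθ1, hC, hR, h1⟩ := oneStepW_of_split b K (fun hb' hI' => momentKilling b hb' hI' (K + 6))
    (molliApprox b (K + 6)) (riemannDisc b (K + 6) (by omega)) hb hI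
  obtain ⟨C₁, hC₁, hS⟩ := slotSynthW_of_oneStepW b (K + 6) K θ C R hθ hθ1 hC hR h1
  exact ⟨C₁, K + 6, hC₁, hS⟩

end Summit.QuantumFields.YangMills.Theorems.AtomicSynthesisWeighted

end
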